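import Literature.MathematicalPhysics.QuantumFieldTheory.WilsonFinTorusElectricFluxSectors
import Literature.Analysis.OperatorTheory.TwistedKernelFluxEnergies
import HarnessLib

/-!
# 't Hooft's electric-flux ENERGIES of the Wilson theory in a finite box: the zero-temperature limit of the flux
# free energies exists, vanishes for zero flux and is strictly positive for every populated non-zero flux

Topic `Literature/MathematicalPhysics/QuantumFieldTheory`; sequel of `WilsonFinTorusElectricFluxSectors.lean`
('t Hooft's flux-projected partition functions `Z_ψ(n) = wilsonFinTorusFluxPartition ρ β φ ψ b₁ b₂ b₃ n` of the box
`b₁ × b₂ × b₃ × n`, eq. (5.4), for a finite abelian group `Γ` of central temporal twists `φ` and a flux label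
`ψ ∈ AddChar Γ ℂ`; non-negativity, `Σ_ψ Z_ψ = Z`, Hopf-explicit decay) and of the kernel-level
`Literature/Analysis/OperatorTheory/TwistedKernelFluxEnergies.lean` (sector tops `Λ_ψ`, 't Hooft's limit).

AS PRINTED.  G. 't Hooft, Nucl. Phys. B 153 (1979) 141, §5 (5.1)–(5.4) and the sentence after (5.4): «In the limit
β → ∞ (or T → 0), F becomes the energy of the lowest state with the given flux configuration. We are interested in
the behaviour of this energy as aᵢ become large.» (reprint C. Rebbi (ed.), *Lattice Gauge Theories and Monte Carlo
Simulations* (1983), p. 553); §8: «Usually, C will be adapted so that F(0; a, β) = 0.»  J. Greensite, *An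
Introduction to the Confinement Problem* (2011) §4.4 (4.41)–(4.44).  Here the inverse temperature is the temporal
period `M + 2` of the box and the energies are normalised to the vacuum (flux-free) sector:

* `wilsonFinTorusFluxEnergy ρ β φ ψ b₁ b₂ b₃ := lim_{M → ∞} (1/M) · log (Re Z_0(M+2) / Re Z_ψ(M+2))` — 't Hooft's
  ELECTRIC-FLUX ENERGY `E(e)` of the box `b₁ × b₂ × b₃` (a DEFINITION via `limUnder`; meaningful for POPULATED sectors,
  `Re Z_ψ(3) > 0`, where the limit is proved to exist);

PROVED (`β ≥ 0`, continuous unitary `ρ` of a compact metrisable `G`, `φ 0 = 1`, `φ (k+k') = φ k φ k'`, `φ k` central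
in the three spatial slots; «populated» = `0 < Re Z_ψ(3)`):

* ★ `tendsto_wilsonFinTorusFluxEnergy` — **the limit exists**: `(1/M) log (Z_0(M+2)/Z_ψ(M+2)) → E_ψ`
  (= `log λ₀ − log Λ_ψ`, the gap between the vacuum level and the top level of the sector);
* `wilsonFinTorusFluxEnergy_zero` — `E_0 = 0` ('t Hooft's normalisation); `wilsonFinTorusFluxEnergy_nonneg` — `E_ψ ≥ 0`;
* ★ `neg_log_tanh_le_wilsonFinTorusFluxEnergy`, `wilsonFinTorusFluxEnergy_pos` — for a populated NON-ZERO flux,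
  `E_ψ ≥ −log tanh(3Nβ·b₁b₂b₃) > 0`: in a finite box every non-zero electric flux costs energy (Hopf's explicit,
  volume-dependent finite-volume gap; the vacuum carries no flux);
* `re_wilsonFinTorusFluxPartition_le_exp_neg_mul` — the finite-temperature bound in energy form:
  `Re Z_ψ(M+2) ≤ c · e^{−E_ψ M} · Re Z_0(M+2)` for all `M`, some `c > 0` (`βF_ψ ≥ E_ψ·M − const`);
* `exists_tendsto_log_wilsonFinTorusFluxPartition_div` — the un-normalised form of 't Hooft's sentence: the free energy
  per unit Euclidean time `−(1/M) log Z_ψ(M+2)` converges, to `−log Λ_ψ` with `Λ_ψ > 0` the top level of the sector,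
  and `Z_ψ(M+2) ≤ Λ_ψ^M Z_ψ(2)`;
* `tendsto_wilsonFinTorusFluxEffectiveEnergy_sub` — the effective flux energies relative to the vacuum channel,
  `log (Z_ψ(M+2)/Z_ψ(M+3)) − log (Z_0(M+2)/Z_0(M+3))`, converge to `E_ψ` (C. Michael 1997 §2 (3)).

HONEST FRAMING: ONE finite box at fixed `β`; `E_ψ = E_ψ(b₁,b₂,b₃; β)` is a finite-volume energy level and the lower
bound `−log tanh(3Nβ·b₁b₂b₃)` tends to `0` exponentially in the spatial volume.  Nothing here is about the behaviour
of `E_ψ` as the box grows — 't Hooft's light∕heavy alternative (§7), `E → ρ·a₁` (7.3), duality (6.3) — nor about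
infinite volume, an area law or a mass gap.

References: 't Hooft 1979 §5, §8; Greensite 2011 §4.4; C. Michael, *Hadronic physics from the lattice* (1997) §2;
E. Hopf, J. Math. Mech. 12 (1963) 683, Thm 4; M. Reed, B. Simon IV (1978) Thm XIII.43–44.
-/

noncomputable section

open MeasureTheory Filter Function Finset Topology
open scoped ENNReal ComplexConjugate BigOperators
open Literature.Analysis.OperatorTheory

namespace Literature.MathematicalPhysics.QuantumFieldTheory

variable {G : Type*} [Group G] [TopologicalSpace G] [IsTopologicalGroup G] [CompactSpace G]
  [MeasurableSpace G] [BorelSpace G] {N : ℕ} (ρ : G →* Matrix (Fin N) (Fin N) ℂ)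
  {Γ : Type*} [AddCommGroup Γ] [Fintype Γ]

/-- **'t Hooft's electric-flux energy of a finite box** (normalised to the flux-free sector):
`E_ψ(b₁,b₂,b₃; β) := lim_{M → ∞} (1/M) · log (Re Z_0(M+2) / Re Z_ψ(M+2))`, the zero-temperature limit of the flux
free energy per unit Euclidean time above the vacuum («In the limit β → ∞, F becomes the energy of the lowest state
with the given flux»; «C will be adapted so that F(0; a, β) = 0»).  Defined through `limUnder`; the limit is proved to
exist for populated sectors (`tendsto_wilsonFinTorusFluxEnergy`).
[cite: tHooft1979Flux, §5 after (5.4) and §8 after (8.7)] [cite: Greensite2011, §4.4 (4.41)–(4.44)] -/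
def wilsonFinTorusFluxEnergy (β : ℝ) (φ : Γ → Fin 4 → G) (ψ : AddChar Γ ℂ) (b₁ b₂ b₃ : ℕ) : ℝ :=
  limUnder atTop fun M : ℕ =>
    Real.log ((wilsonFinTorusFluxPartition ρ β φ 0 b₁ b₂ b₃ (M + 2)).re /
        (wilsonFinTorusFluxPartition ρ β φ ψ b₁ b₂ b₃ (M + 2)).re) / M

/-- Unfolding lemma. [cite: tHooft1979Flux, §5 after (5.4)] -/
theorem wilsonFinTorusFluxEnergy_def (β : ℝ) (φ : Γ → Fin 4 → G) (ψ : AddChar Γ ℂ) (b₁ b₂ b₃ : ℕ) :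
    wilsonFinTorusFluxEnergy ρ β φ ψ b₁ b₂ b₃ = limUnder atTop (fun M : ℕ =>
      Real.log ((wilsonFinTorusFluxPartition ρ β φ 0 b₁ b₂ b₃ (M + 2)).re /
        (wilsonFinTorusFluxPartition ρ β φ ψ b₁ b₂ b₃ (M + 2)).re) / M) := rfl

/-- **The flux-free energy vanishes**: `E_0 = 0` ('t Hooft's normalisation `F(0) = 0`; no hypotheses).
[cite: tHooft1979Flux, §8 after (8.7)] -/
theorem wilsonFinTorusFluxEnergy_zero (β : ℝ) (φ : Γ → Fin 4 → G) (b₁ b₂ b₃ : ℕ) :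
    wilsonFinTorusFluxEnergy ρ β φ 0 b₁ b₂ b₃ = 0 := by
  rw [wilsonFinTorusFluxEnergy_def]
  have h : (fun M : ℕ => Real.log ((wilsonFinTorusFluxPartition ρ β φ 0 b₁ b₂ b₃ (M + 2)).re /
      (wilsonFinTorusFluxPartition ρ β φ 0 b₁ b₂ b₃ (M + 2)).re) / (M : ℝ)) = fun _ => 0 := by
    funext M
    rcases eq_or_ne ((wilsonFinTorusFluxPartition ρ β φ 0 b₁ b₂ b₃ (M + 2)).re) 0 with h0 | h0
    · simp [h0]
    · simp [div_self h0]
  rw [h]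
  exact tendsto_const_nhds.limUnder_eq

section Spectral

variable [SecondCountableTopology G]

/-- `0 ≤ tanh x` for `0 ≤ x` (plumbing). [folklore] -/
private theorem tanh_nonneg_of_nonneg {x : ℝ} (hx : 0 ≤ x) : 0 ≤ Real.tanh x := by
  rw [Real.tanh_eq_sinh_div_cosh]
  exact div_nonneg (Real.sinh_nonneg_iff.2 hx) (Real.cosh_pos x).le

/-- `tanh x < 1` (plumbing). [folklore] -/
private theorem tanh_lt_one' (x : ℝ) : Real.tanh x < 1 := by
  rw [Real.tanh_eq_sinh_div_cosh, div_lt_one (Real.cosh_pos x)]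
  exact Real.sinh_lt_cosh x

/-- MASTER LEMMA (plumbing): the spectral description of a populated flux sector of the box — the vacuum level
`λ₀ = ‖𝕋‖`, the sector top `Λ_ψ`, Hopf's ratio bound for `ψ ≠ 0`, 't Hooft's limit, the sharp sector decay, the
vacuum lower bound, positivity, and the convergence of the relative effective energies. [folklore] -/
private theorem fluxEnergy_spectral (hρ : Continuous ρ) (hρu : ∀ g, ρ g ∈ Matrix.unitaryGroup (Fin N) ℂ)
    {β : ℝ} (hβ : 0 ≤ β) {φ : Γ → Fin 4 → G} (hφ0 : φ 0 = 1) (hφadd : ∀ k k', φ (k + k') = φ k * φ k')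
    (hφc : ∀ k (i : Fin 3), φ k i.castSucc ∈ Subgroup.center G) (b₁ b₂ b₃ : ℕ) {ψ : AddChar Γ ℂ}
    (hψ3 : 0 < (wilsonFinTorusFluxPartition ρ β φ ψ b₁ b₂ b₃ 3).re) :
    ∃ lam₀ Λψ : ℝ, 0 < Λψ ∧ Λψ ≤ lam₀ ∧
      (ψ ≠ 0 → Λψ ≤ Real.tanh (3 * N * β * ((b₁ : ℝ) * b₂ * b₃)) * lam₀) ∧
      Tendsto (fun M : ℕ => Real.log ((wilsonFinTorusFluxPartition ρ β φ 0 b₁ b₂ b₃ (M + 2)).re /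
          (wilsonFinTorusFluxPartition ρ β φ ψ b₁ b₂ b₃ (M + 2)).re) / M) atTop
        (𝓝 (Real.log lam₀ - Real.log Λψ)) ∧
      (∀ M : ℕ, (wilsonFinTorusFluxPartition ρ β φ ψ b₁ b₂ b₃ (M + 2)).re ≤
          Λψ ^ M * (wilsonFinTorusFluxPartition ρ β φ ψ b₁ b₂ b₃ 2).re) ∧
      (∀ M : ℕ, lam₀ ^ M * lam₀ ^ 2 ≤ (wilsonFinTorusFluxPartition ρ β φ 0 b₁ b₂ b₃ (M + 2)).re) ∧
      (∀ M : ℕ, 0 < (wilsonFinTorusFluxPartition ρ β φ ψ b₁ b₂ b₃ (M + 2)).re) ∧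
      Tendsto (fun M : ℕ => Real.log (wilsonFinTorusFluxPartition ρ β φ ψ b₁ b₂ b₃ (M + 2)).re / M) atTop
        (𝓝 (Real.log Λψ)) ∧
      Tendsto (fun M : ℕ =>
          Real.log ((wilsonFinTorusFluxPartition ρ β φ ψ b₁ b₂ b₃ (M + 2)).re /
              (wilsonFinTorusFluxPartition ρ β φ ψ b₁ b₂ b₃ (M + 1 + 2)).re) -
            Real.log ((wilsonFinTorusFluxPartition ρ β φ 0 b₁ b₂ b₃ (M + 2)).re /
              (wilsonFinTorusFluxPartition ρ β φ 0 b₁ b₂ b₃ (M + 1 + 2)).re)) atTop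
        (𝓝 (Real.log lam₀ - Real.log Λψ)) := by
  haveI : IsFiniteMeasure (haarProbability G) := by
    dsimp [haarProbability]; infer_instance
  obtain ⟨C, A, s, hcnt, b, lam, i₀, hC, hA, hb, hlam, hi₀, hL0⟩ :=
    exists_eigenbasis_finTorusSliceKernel hρ hρu hβ b₁ b₂ b₃
  haveI : Countable s := hcnt
  have hK := stronglyMeasurable_uncurry_finTorusSliceKernel (b₁ := b₁) (b₂ := b₂) (b₃ := b₃) ρ hρ β
  have hsymm : ∀ x y : FinSpatialSite b₁ b₂ b₃ × Fin 3 → G,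
      finTorusSliceKernel ρ β x y = finTorusSliceKernel ρ β y x := finTorusSliceKernel_symm ρ hρu β
  have hKpos : ∀ x y : FinSpatialSite b₁ b₂ b₃ × Fin 3 → G, 0 < finTorusSliceKernel ρ β x y :=
    finTorusSliceKernel_pos ρ hρ β
  have hT0 : (finSliceTwist (φ 0) : (FinSpatialSite b₁ b₂ b₃ × Fin 3 → G) → _) = id := by
    rw [hφ0]; exact finSliceTwist_one
  have hTadd : ∀ (k k' : Γ) (x : FinSpatialSite b₁ b₂ b₃ × Fin 3 → G),
      finSliceTwist (φ (k + k')) x = finSliceTwist (φ k) (finSliceTwist (φ k') x) := fun k k' x => by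
    rw [finSliceTwist_finSliceTwist, hφadd]
  have hT : ∀ k : Γ, MeasurePreserving (finSliceTwist (φ k) : (FinSpatialSite b₁ b₂ b₃ × Fin 3 → G) → _)
      (Measure.pi fun _ => haarProbability G) (Measure.pi fun _ => haarProbability G) :=
    fun k => measurePreserving_finSliceTwist (φ k)
  have hKT : ∀ (k : Γ) (x y : FinSpatialSite b₁ b₂ b₃ × Fin 3 → G),
      finTorusSliceKernel ρ β (finSliceTwist (φ k) x) (finSliceTwist (φ k) y) = finTorusSliceKernel ρ β x y :=
    fun k x y => finTorusSliceKernel_finSliceTwist ρ (hφc k) β x y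
  have hz : ∀ (k : Γ) (M : ℕ), (fun k n => wilsonFinTorusTwistedPartition ρ β (φ k) b₁ b₂ b₃ n) k (M + 2) =
      ∫ x, ((fun f : (FinSpatialSite b₁ b₂ b₃ × Fin 3 → G) → ℝ => fun w =>
            ∫ y, finTorusSliceKernel ρ β w y * f y
              ∂(Measure.pi fun _ : FinSpatialSite b₁ b₂ b₃ × Fin 3 => haarProbability G))^[M + 1]
          (fun y => finTorusSliceKernel ρ β y x)) (finSliceTwist (φ k) x)
        ∂(Measure.pi fun _ : FinSpatialSite b₁ b₂ b₃ × Fin 3 => haarProbability G) :=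
    fun k M => wilsonFinTorusTwistedPartition_eq_integral_iterate ρ hρ β (hφc k) b₁ b₂ b₃ M
  have hlam0 : ∀ i, 0 ≤ lam i := fun i => (hlam i).1
  -- Hopf's ratio bound: `λᵢ ≤ τ λ₀` off the top index
  have hHopf : ∀ i, i ≠ i₀ → lam i ≤ Real.tanh (3 * N * β * ((b₁ : ℝ) * b₂ * b₃)) * lam i₀ := fun i hi => by
    have h := WilsonFinTorusHopf.abs_eigenvalue_le_tanh_mul (b₁ := b₁) (b₂ := b₂) (b₃ := b₃) ρ hρ hρu hβ hA b hb hi₀ hi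
    rw [← hi₀] at h
    exact (le_abs_self _).trans h
  have hτ0 : 0 ≤ Real.tanh (3 * N * β * ((b₁ : ℝ) * b₂ * b₃)) * lam i₀ :=
    mul_nonneg (tanh_nonneg_of_nonneg (by positivity)) (hlam0 i₀)
  -- the sector is non-degenerate
  have hne := exists_fluxCoeff_ne_zero_of_pos (T := fun k => finSliceTwist (φ k)) hK hC hsymm hA hb hlam0 hT hz
    (ψ := ψ) hψ3
  have hne0 := exists_fluxCoeff_zero_ne_zero (T := fun k => finSliceTwist (φ k)) hK hC hsymm hKpos hA hb hT hKT hi₀ hL0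
  refine ⟨lam i₀, ⨆ i : {i // ((Fintype.card Γ : ℂ)⁻¹ * ∑ k, conj (ψ k) *
      ((∫ x, (∫ z, finTorusSliceKernel ρ β (finSliceTwist (φ k) x) z * b i z
          ∂(Measure.pi fun _ : FinSpatialSite b₁ b₂ b₃ × Fin 3 => haarProbability G)) *
        (∫ z, finTorusSliceKernel ρ β x z * b i z
          ∂(Measure.pi fun _ : FinSpatialSite b₁ b₂ b₃ × Fin 3 => haarProbability G))
        ∂(Measure.pi fun _ : FinSpatialSite b₁ b₂ b₃ × Fin 3 => haarProbability G) : ℝ) : ℂ)).re ≠ 0}, lam i,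
    ?_, ?_, ?_, ?_, ?_, ?_, ?_, ?_, ?_⟩
  · exact spectralTop_pos (lam_le_norm hb) hne
  · exact fluxTop_le_top hb hi₀ ψ
  · exact fun hψ => fluxTop_le_of_ne_zero hK hC hsymm hKpos hA hb hT hKT hi₀ hL0 hτ0 hHopf hψ
  · exact tendsto_log_fluxSector_ratio_div hK hC hsymm hKpos hA hb hlam0 hi₀ hL0 hT hT0 hTadd hKT hz hne
  · exact fun M => re_fluxSector_le_fluxTop_pow_mul hK hC hsymm hA hb hlam0 hT hT0 hTadd hz ψ M
  · exact fun M => le_re_fluxSector_zero (T := fun k => finSliceTwist (φ k)) hK hC hsymm hKpos hA hb hlam0 hi₀ hL0 hT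
      hT0 hTadd hKT hz M
  · exact fun M => re_fluxSector_pos hK hC hsymm hA hb hlam0 hT hT0 hTadd hz hne M
  · exact tendsto_log_re_fluxSector_div hK hC hsymm hA hb hlam0 hT hT0 hTadd hz hne
  · have hψlim := tendsto_fluxEffectiveEnergy hK hC hsymm hA hb hlam0 hT hT0 hTadd hz hne
    have h0lim := tendsto_fluxEffectiveEnergy hK hC hsymm hA hb hlam0 hT hT0 hTadd hz hne0
    rw [fluxTop_zero_eq hK hC hsymm hKpos hA hb hT hKT hi₀ hL0] at h0lim
    have h := hψlim.sub h0lim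
    rwa [neg_sub_neg] at h

/-- ★ **The zero-temperature limit exists** — 't Hooft's «in the limit β → ∞, F becomes the energy of the lowest
state with the given flux»: for a populated sector (`Re Z_ψ(3) > 0`),
`(1/M) · log (Re Z_0(M+2) / Re Z_ψ(M+2)) → E_ψ = wilsonFinTorusFluxEnergy ρ β φ ψ b₁ b₂ b₃` as `M → ∞`.
[cite: tHooft1979Flux, §5 after (5.4)] [cite: Greensite2011, §4.4 (4.41)–(4.44)] -/
theorem tendsto_wilsonFinTorusFluxEnergy (hρ : Continuous ρ) (hρu : ∀ g, ρ g ∈ Matrix.unitaryGroup (Fin N) ℂ)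
    {β : ℝ} (hβ : 0 ≤ β) {φ : Γ → Fin 4 → G} (hφ0 : φ 0 = 1) (hφadd : ∀ k k', φ (k + k') = φ k * φ k')
    (hφc : ∀ k (i : Fin 3), φ k i.castSucc ∈ Subgroup.center G) (b₁ b₂ b₃ : ℕ) {ψ : AddChar Γ ℂ}
    (hψ3 : 0 < (wilsonFinTorusFluxPartition ρ β φ ψ b₁ b₂ b₃ 3).re) :
    Tendsto (fun M : ℕ => Real.log ((wilsonFinTorusFluxPartition ρ β φ 0 b₁ b₂ b₃ (M + 2)).re /
        (wilsonFinTorusFluxPartition ρ β φ ψ b₁ b₂ b₃ (M + 2)).re) / M) atTop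
      (𝓝 (wilsonFinTorusFluxEnergy ρ β φ ψ b₁ b₂ b₃)) := by
  obtain ⟨lam₀, Λψ, -, -, -, ht, -⟩ := fluxEnergy_spectral ρ hρ hρu hβ hφ0 hφadd hφc b₁ b₂ b₃ hψ3
  rw [wilsonFinTorusFluxEnergy_def, ht.limUnder_eq]
  exact ht

/-- **Flux energies are non-negative**: `0 ≤ E_ψ` for every populated sector (`Λ_ψ ≤ λ₀`: no level exceeds the
vacuum). [cite: tHooft1979Flux, §5 (5.1)–(5.4)] [cite: ReedSimonIV1978, Thm XIII.43 and Thm XIII.44] -/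
theorem wilsonFinTorusFluxEnergy_nonneg (hρ : Continuous ρ) (hρu : ∀ g, ρ g ∈ Matrix.unitaryGroup (Fin N) ℂ)
    {β : ℝ} (hβ : 0 ≤ β) {φ : Γ → Fin 4 → G} (hφ0 : φ 0 = 1) (hφadd : ∀ k k', φ (k + k') = φ k * φ k')
    (hφc : ∀ k (i : Fin 3), φ k i.castSucc ∈ Subgroup.center G) (b₁ b₂ b₃ : ℕ) {ψ : AddChar Γ ℂ}
    (hψ3 : 0 < (wilsonFinTorusFluxPartition ρ β φ ψ b₁ b₂ b₃ 3).re) :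
    0 ≤ wilsonFinTorusFluxEnergy ρ β φ ψ b₁ b₂ b₃ := by
  obtain ⟨lam₀, Λψ, hΛpos, hΛle, -, ht, -⟩ := fluxEnergy_spectral ρ hρ hρu hβ hφ0 hφadd hφc b₁ b₂ b₃ hψ3
  rw [wilsonFinTorusFluxEnergy_def, ht.limUnder_eq]
  exact sub_nonneg.2 (Real.log_le_log hΛpos hΛle)

/-- ★ **A non-zero electric flux of a finite box costs at least the finite-volume gap**: for `ψ ≠ 0` populated,
`−log tanh(3Nβ·b₁b₂b₃) ≤ E_ψ` — the vacuum is flux-free ('t Hooft §4) and Hopf's bound puts every other level below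
`tanh(3Nβ·b₁b₂b₃)·λ₀`. [cite: tHooft1979Flux, §4 (4.3)–(4.5) and §5 after (5.4)] [cite: Hopf1963, Thm 4] -/
theorem neg_log_tanh_le_wilsonFinTorusFluxEnergy (hρ : Continuous ρ) (hρu : ∀ g, ρ g ∈ Matrix.unitaryGroup (Fin N) ℂ)
    {β : ℝ} (hβ : 0 ≤ β) {φ : Γ → Fin 4 → G} (hφ0 : φ 0 = 1) (hφadd : ∀ k k', φ (k + k') = φ k * φ k')
    (hφc : ∀ k (i : Fin 3), φ k i.castSucc ∈ Subgroup.center G) (b₁ b₂ b₃ : ℕ) {ψ : AddChar Γ ℂ} (hψ : ψ ≠ 0)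
    (hψ3 : 0 < (wilsonFinTorusFluxPartition ρ β φ ψ b₁ b₂ b₃ 3).re) :
    -Real.log (Real.tanh (3 * N * β * ((b₁ : ℝ) * b₂ * b₃))) ≤ wilsonFinTorusFluxEnergy ρ β φ ψ b₁ b₂ b₃ := by
  obtain ⟨lam₀, Λψ, hΛpos, hΛle, hτ, ht, -⟩ := fluxEnergy_spectral ρ hρ hρu hβ hφ0 hφadd hφc b₁ b₂ b₃ hψ3
  rw [wilsonFinTorusFluxEnergy_def, ht.limUnder_eq]
  have hτψ := hτ hψ
  have hlam₀ : 0 < lam₀ := lt_of_lt_of_le hΛpos hΛle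
  rcases (tanh_nonneg_of_nonneg (x := 3 * N * β * ((b₁ : ℝ) * b₂ * b₃)) (by positivity)).eq_or_lt with h0 | hpos
  · -- degenerate rate `τ = 0` cannot occur with a populated non-zero sector
    rw [← h0, zero_mul] at hτψ
    exact absurd hτψ (not_le.2 hΛpos)
  · have h1 : Real.log Λψ ≤ Real.log (Real.tanh (3 * N * β * ((b₁ : ℝ) * b₂ * b₃))) + Real.log lam₀ := by
      rw [← Real.log_mul hpos.ne' hlam₀.ne']
      exact Real.log_le_log hΛpos hτψ
    linarith

/-- ★ **Every populated non-zero electric flux of a finite box has strictly positive energy**: `0 < E_ψ`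
(`tanh < 1`).  A ONE-BOX statement; the bound degenerates exponentially in the spatial volume.
[cite: tHooft1979Flux, §5 after (5.4)] [cite: Hopf1963, Thm 4] -/
theorem wilsonFinTorusFluxEnergy_pos (hρ : Continuous ρ) (hρu : ∀ g, ρ g ∈ Matrix.unitaryGroup (Fin N) ℂ)
    {β : ℝ} (hβ : 0 ≤ β) {φ : Γ → Fin 4 → G} (hφ0 : φ 0 = 1) (hφadd : ∀ k k', φ (k + k') = φ k * φ k')
    (hφc : ∀ k (i : Fin 3), φ k i.castSucc ∈ Subgroup.center G) (b₁ b₂ b₃ : ℕ) {ψ : AddChar Γ ℂ} (hψ : ψ ≠ 0)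
    (hψ3 : 0 < (wilsonFinTorusFluxPartition ρ β φ ψ b₁ b₂ b₃ 3).re) :
    0 < wilsonFinTorusFluxEnergy ρ β φ ψ b₁ b₂ b₃ := by
  obtain ⟨lam₀, Λψ, hΛpos, hΛle, hτ, ht, -⟩ := fluxEnergy_spectral ρ hρ hρu hβ hφ0 hφadd hφc b₁ b₂ b₃ hψ3
  rw [wilsonFinTorusFluxEnergy_def, ht.limUnder_eq]
  have hτψ := hτ hψ
  have hlam₀ : 0 < lam₀ := lt_of_lt_of_le hΛpos hΛle
  have hlt : Λψ < lam₀ := by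
    refine lt_of_le_of_lt hτψ ?_
    calc Real.tanh (3 * N * β * ((b₁ : ℝ) * b₂ * b₃)) * lam₀ < 1 * lam₀ :=
        mul_lt_mul_of_pos_right (tanh_lt_one' _) hlam₀
      _ = lam₀ := one_mul _
  exact sub_pos.2 (Real.log_lt_log hΛpos hlt)

/-- **The finite-temperature bound in energy form**: for a populated sector there is `c > 0` with
`Re Z_ψ(M+2) ≤ c · e^{−E_ψ·M} · Re Z_0(M+2)` for every `M` — the flux free energy at inverse temperature `M + 2`
exceeds `E_ψ·M` up to an `M`-independent constant (`c = Re Z_ψ(2)/λ₀²`).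
[cite: tHooft1979Flux, §5 after (5.4)] [cite: ReedSimonIV1978, Thm XIII.43 and Thm XIII.44] -/
theorem re_wilsonFinTorusFluxPartition_le_exp_neg_mul (hρ : Continuous ρ)
    (hρu : ∀ g, ρ g ∈ Matrix.unitaryGroup (Fin N) ℂ) {β : ℝ} (hβ : 0 ≤ β) {φ : Γ → Fin 4 → G} (hφ0 : φ 0 = 1)
    (hφadd : ∀ k k', φ (k + k') = φ k * φ k') (hφc : ∀ k (i : Fin 3), φ k i.castSucc ∈ Subgroup.center G)
    (b₁ b₂ b₃ : ℕ) {ψ : AddChar Γ ℂ} (hψ3 : 0 < (wilsonFinTorusFluxPartition ρ β φ ψ b₁ b₂ b₃ 3).re) :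
    ∃ c : ℝ, 0 < c ∧ ∀ M : ℕ,
      (wilsonFinTorusFluxPartition ρ β φ ψ b₁ b₂ b₃ (M + 2)).re ≤
        c * Real.exp (-(wilsonFinTorusFluxEnergy ρ β φ ψ b₁ b₂ b₃ * M)) *
          (wilsonFinTorusFluxPartition ρ β φ 0 b₁ b₂ b₃ (M + 2)).re := by
  obtain ⟨lam₀, Λψ, hΛpos, hΛle, -, ht, hdec, hvac, hpos, -⟩ :=
    fluxEnergy_spectral ρ hρ hρu hβ hφ0 hφadd hφc b₁ b₂ b₃ hψ3
  rw [wilsonFinTorusFluxEnergy_def, ht.limUnder_eq]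
  have hlam₀ : 0 < lam₀ := lt_of_lt_of_le hΛpos hΛle
  refine ⟨(wilsonFinTorusFluxPartition ρ β φ ψ b₁ b₂ b₃ 2).re / lam₀ ^ 2, div_pos (hpos 0) (pow_pos hlam₀ 2),
    fun M => ?_⟩
  -- `e^{−E M} = (Λ_ψ/λ₀)^M` with `E = log λ₀ − log Λ_ψ = −log(Λ_ψ/λ₀)`
  have hE : Real.log lam₀ - Real.log Λψ = -Real.log (Λψ / lam₀) := by
    rw [Real.log_div hΛpos.ne' hlam₀.ne']; ring
  rw [hE]
  have hexp' : Real.exp (-(-Real.log (Λψ / lam₀) * M)) = (Λψ / lam₀) ^ M := by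
    rw [show -(-Real.log (Λψ / lam₀) * (M : ℝ)) = (M : ℝ) * Real.log (Λψ / lam₀) by ring, Real.exp_nat_mul,
      Real.exp_log (div_pos hΛpos hlam₀)]
  rw [hexp']
  calc (wilsonFinTorusFluxPartition ρ β φ ψ b₁ b₂ b₃ (M + 2)).re
      ≤ Λψ ^ M * (wilsonFinTorusFluxPartition ρ β φ ψ b₁ b₂ b₃ 2).re := hdec M
    _ = (wilsonFinTorusFluxPartition ρ β φ ψ b₁ b₂ b₃ 2).re / lam₀ ^ 2 * (Λψ / lam₀) ^ M * (lam₀ ^ M * lam₀ ^ 2) := by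
        rw [div_pow]
        field_simp
    _ ≤ (wilsonFinTorusFluxPartition ρ β φ ψ b₁ b₂ b₃ 2).re / lam₀ ^ 2 * (Λψ / lam₀) ^ M *
          (wilsonFinTorusFluxPartition ρ β φ 0 b₁ b₂ b₃ (M + 2)).re :=
        mul_le_mul_of_nonneg_left (hvac M)
          (mul_nonneg (div_pos (hpos 0) (pow_pos hlam₀ 2)).le (pow_nonneg (div_pos hΛpos hlam₀).le M))

/-- **'t Hooft's sentence, un-normalised**: for a populated sector the flux free energy per unit Euclidean time
`−(1/M) log Re Z_ψ(M+2)` CONVERGES, namely `(1/M) log Re Z_ψ(M+2) → log Λ_ψ` for some `Λ_ψ > 0` (the top level of the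
sector; `−log Λ_ψ` is the energy of its lowest state), which moreover bounds every finite temperature:
`Re Z_ψ(M+2) ≤ Λ_ψ^M · Re Z_ψ(2)`. [cite: tHooft1979Flux, §5 after (5.4)] [cite: Greensite2011, §4.4 (4.41)–(4.44)] -/
theorem exists_tendsto_log_wilsonFinTorusFluxPartition_div (hρ : Continuous ρ)
    (hρu : ∀ g, ρ g ∈ Matrix.unitaryGroup (Fin N) ℂ) {β : ℝ} (hβ : 0 ≤ β) {φ : Γ → Fin 4 → G} (hφ0 : φ 0 = 1)
    (hφadd : ∀ k k', φ (k + k') = φ k * φ k') (hφc : ∀ k (i : Fin 3), φ k i.castSucc ∈ Subgroup.center G)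
    (b₁ b₂ b₃ : ℕ) {ψ : AddChar Γ ℂ} (hψ3 : 0 < (wilsonFinTorusFluxPartition ρ β φ ψ b₁ b₂ b₃ 3).re) :
    ∃ Λψ : ℝ, 0 < Λψ ∧
      Tendsto (fun M : ℕ => Real.log (wilsonFinTorusFluxPartition ρ β φ ψ b₁ b₂ b₃ (M + 2)).re / M) atTop
        (𝓝 (Real.log Λψ)) ∧
      ∀ M : ℕ, (wilsonFinTorusFluxPartition ρ β φ ψ b₁ b₂ b₃ (M + 2)).re ≤
        Λψ ^ M * (wilsonFinTorusFluxPartition ρ β φ ψ b₁ b₂ b₃ 2).re := by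
  obtain ⟨lam₀, Λψ, hΛpos, -, -, -, hdec, -, -, hlim, -⟩ :=
    fluxEnergy_spectral ρ hρ hρu hβ hφ0 hφadd hφc b₁ b₂ b₃ hψ3
  exact ⟨Λψ, hΛpos, hlim, hdec⟩

/-- **Effective flux energies**: for a populated sector the effective energies relative to the vacuum channel,
`log (Re Z_ψ(M+2)/Re Z_ψ(M+3)) − log (Re Z_0(M+2)/Re Z_0(M+3))`, converge to `E_ψ` (Michael's
`m̂₀ = lim m̂_eff(t)` in the flux channel, normalised to the vacuum).
[cite: Michael1997, §2 eqs. (2)–(3)] [cite: tHooft1979Flux, §5 after (5.4)] -/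
theorem tendsto_wilsonFinTorusFluxEffectiveEnergy_sub (hρ : Continuous ρ)
    (hρu : ∀ g, ρ g ∈ Matrix.unitaryGroup (Fin N) ℂ) {β : ℝ} (hβ : 0 ≤ β) {φ : Γ → Fin 4 → G} (hφ0 : φ 0 = 1)
    (hφadd : ∀ k k', φ (k + k') = φ k * φ k') (hφc : ∀ k (i : Fin 3), φ k i.castSucc ∈ Subgroup.center G)
    (b₁ b₂ b₃ : ℕ) {ψ : AddChar Γ ℂ} (hψ3 : 0 < (wilsonFinTorusFluxPartition ρ β φ ψ b₁ b₂ b₃ 3).re) :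
    Tendsto (fun M : ℕ =>
        Real.log ((wilsonFinTorusFluxPartition ρ β φ ψ b₁ b₂ b₃ (M + 2)).re /
            (wilsonFinTorusFluxPartition ρ β φ ψ b₁ b₂ b₃ (M + 1 + 2)).re) -
          Real.log ((wilsonFinTorusFluxPartition ρ β φ 0 b₁ b₂ b₃ (M + 2)).re /
            (wilsonFinTorusFluxPartition ρ β φ 0 b₁ b₂ b₃ (M + 1 + 2)).re)) atTop
      (𝓝 (wilsonFinTorusFluxEnergy ρ β φ ψ b₁ b₂ b₃)) := by
  obtain ⟨lam₀, Λψ, -, -, -, ht, -, -, -, -, heff⟩ := fluxEnergy_spectral ρ hρ hρu hβ hφ0 hφadd hφc b₁ b₂ b₃ hψ3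
  rw [wilsonFinTorusFluxEnergy_def, ht.limUnder_eq]
  exact heff

end Spectral

end Literature.MathematicalPhysics.QuantumFieldTheory

end
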